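import Literature.MathematicalPhysics.QuantumLattice.HubbardPairDensityCouplingFloorSharp
import Literature.MathematicalPhysics.QuantumLattice.FreeFermiGasPairingCostOptimal
import HarnessLib

/-!
# Ground-state `d`-wave pair density of the repulsive Hubbard torus is `O(U^{2/3})`

Family `hubbard` / topic `MathematicalPhysics/QuantumLattice`; third stage of
`HubbardPairDensityCouplingFloor.lean` (`c ≤ 48(U/4)^{1/6}`) and
`HubbardPairDensityCouplingFloorSharp.lean` (`min(c,1) ≤ 8192 √U`). With the `a^{3/2}` pairing-cost
rate of `FreeFermiGasPairingCostOptimal.lean` (triangle bounds for the pair operator instead of the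
pair Gram bound) the same two-line energy balance gives:

* `hubbardTorus_groundState_pairLRO_coupling_floor_opt`: a normalised ground state `ψ` of
  `hubbardTorus 2 L 1 U` (`U ≥ 0`) in a sector `(2n, S^z = 0)`, `n ≤ L²`, `L ≥ ⌈1536/c⌉ + 3`, with
  `Re ⟨ψ, Δ_d†Δ_d ψ⟩ ≥ c·L⁴` (`c > 0`) forces `c√c/32768 ≤ U`;
* `pairDensity_cube_le_mul_coupling_sq` / `pairDensity_le_mul_coupling_rpow`: equivalently
  `c³ ≤ 2³⁰·U²`, i.e. `c ≤ 1024·U^{2/3}` — the ground-state `d`-wave pair density of the weakly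
  repulsive Hubbard torus is `O(U^{2/3})` as `U → 0⁺`, uniformly in the filling and in `L` beyond the
  finite-size threshold (no `min(c,1)` needed any more);
* `re_expect_pairField_dWave_lt_of_groundStateInSector_opt`: for `0 ≤ U < c√c/32768`, EVERY
  normalised sector ground state has `Re ⟨ψ, Δ_d†Δ_d ψ⟩ < c·L⁴`;
* `hubbardTorus_groundState_pairDensity_lt_of_coupling_sq_lt`: the same for every `N`, from
  `2³⁰ U² < c³`.

Mechanism (unchanged): the interacting ground state has free kinetic energy at most `U·L²` above the
free sector ground energy (`re_expect_hubbardTorus_zero_le_of_groundStateInSector`), while pair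
density `c` costs `(c√c/32768)·L²` (`freeDWavePairing_costs_energy_opt_rate`). The exponent `2/3` is
what the first-order kinetic budget gives with the uniform (van-Hove-safe) `√η` level count; the
linear level count away from half filling would give `c ≲ U log(1/U)`; the expected truth is
`e^{-O(1/U)}`-small — neither is claimed here.

Sources: Bardeen–Cooper–Schrieffer, Phys. Rev. 108 (1957) 1175, §II; C. N. Yang, Rev. Mod. Phys. 34
(1962) 694, §3; H. Tasaki, Physics and Mathematics of Quantum Many-Body Systems (2020) §2.2
(variational principle). Folklore finite-dimensional statements; no named facts, no definitions.
Tree search: `hubbardTorus_groundState_pairLRO_coupling_floor_sharp` (`√U` companion),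
`re_expect_hubbardTorus_zero_le_of_groundStateInSector`, `freeDWavePairing_costs_energy_opt_rate`,
`le_sq_of_mem_szSector_two_mul_zero`. Mathlib: `Real.pow_rpow_inv_natCast`, `Real.mul_rpow`,
`Real.rpow_mul`, `Real.rpow_le_rpow`.
-/

noncomputable section

namespace Literature.MathematicalPhysics.QuantumLattice

open Matrix Finset Literature.Probability.LatticeModels
open scoped ComplexOrder ComplexConjugate

variable {L : ℕ} [NeZero L]

/-- **Coupling floor for `d`-wave pair LRO in a sector ground state, rate `c^{3/2}`.** If a
normalised ground state `ψ` of `hubbardTorus 2 L 1 U` (`U ≥ 0`) in a sector `(2n, S^z = 0)`,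
`n ≤ L²`, `L ≥ ⌈1536/c⌉ + 3`, has `Re ⟨ψ, Δ_d†Δ_d ψ⟩ ≥ c·L⁴` (`c > 0`), then `c√c/32768 ≤ U`.
Bardeen–Cooper–Schrieffer (1957) §II; Tasaki (2020) §2.2. [folklore] -/
theorem hubbardTorus_groundState_pairLRO_coupling_floor_opt {c U : ℝ} (hc : 0 < c) (hU : 0 ≤ U)
    (hL : ⌈1536 / c⌉₊ + 3 ≤ L) {n : ℕ} (hn : n ≤ L ^ 2) {ψ : Fock (Orb (FermionTorus 2 L))}
    (hψ : IsGroundStateInSector (hubbardTorus 2 L 1 U) (2 * n) 0 ψ) (h1 : star ψ ⬝ᵥ ψ = 1)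
    (hY : c * (L : ℝ) ^ 4 ≤
      (star ψ ⬝ᵥ (((pairField dWaveFormFactor L)ᴴ * pairField dWaveFormFactor L) *ᵥ ψ)).re) :
    c * Real.sqrt c / 32768 ≤ U := by
  have hcost := freeDWavePairing_costs_energy_opt_rate hc hL hψ.1 h1 hY
  have hfree := re_expect_hubbardTorus_zero_le_of_groundStateInSector hU hn hψ h1
  have hL2 : (0 : ℝ) < (L : ℝ) ^ 2 := by
    have : (0 : ℝ) < (L : ℝ) := by exact_mod_cast Nat.pos_of_ne_zero (NeZero.ne L)
    positivity
  have hmul : c * Real.sqrt c / 32768 * (L : ℝ) ^ 2 ≤ U * (L : ℝ) ^ 2 := by linarith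
  exact le_of_mul_le_mul_right hmul hL2

/-- **Cube form**: under the hypotheses of `hubbardTorus_groundState_pairLRO_coupling_floor_opt`,
`c³ ≤ 2³⁰·U²` (`(c√c)² = c³`). [folklore] -/
theorem pairDensity_cube_le_mul_coupling_sq {c U : ℝ} (hc : 0 < c) (hU : 0 ≤ U)
    (hL : ⌈1536 / c⌉₊ + 3 ≤ L) {n : ℕ} (hn : n ≤ L ^ 2) {ψ : Fock (Orb (FermionTorus 2 L))}
    (hψ : IsGroundStateInSector (hubbardTorus 2 L 1 U) (2 * n) 0 ψ) (h1 : star ψ ⬝ᵥ ψ = 1)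
    (hY : c * (L : ℝ) ^ 4 ≤
      (star ψ ⬝ᵥ (((pairField dWaveFormFactor L)ᴴ * pairField dWaveFormFactor L) *ᵥ ψ)).re) :
    c ^ 3 ≤ 2 ^ 30 * U ^ 2 := by
  have h := hubbardTorus_groundState_pairLRO_coupling_floor_opt hc hU hL hn hψ h1 hY
  have h0 : 0 ≤ c * Real.sqrt c := by positivity
  have h' : c * Real.sqrt c ≤ 32768 * U := by linarith
  have h2 := pow_le_pow_left₀ h0 h' 2
  rw [mul_pow, Real.sq_sqrt hc.le, mul_pow] at h2
  calc c ^ 3 = c ^ 2 * c := by ring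
    _ ≤ 32768 ^ 2 * U ^ 2 := h2
    _ = 2 ^ 30 * U ^ 2 := by norm_num

/-- **The ground-state `d`-wave pair density is `O(U^{2/3})`.** Under the hypotheses of
`hubbardTorus_groundState_pairLRO_coupling_floor_opt`: `c ≤ 1024·U^{2/3}`. In words: a sector ground
state of the repulsive Hubbard torus at coupling `U ≥ 0` (any filling, `L` beyond the finite-size
threshold `⌈1536/c⌉ + 3`) carries `d`-wave pair order `Re⟨Δ_d†Δ_d⟩ ≥ c·L⁴` only if
`c ≤ 1024 U^{2/3}`. Bardeen–Cooper–Schrieffer (1957) §II. [folklore] -/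
theorem pairDensity_le_mul_coupling_rpow {c U : ℝ} (hc : 0 < c) (hU : 0 ≤ U)
    (hL : ⌈1536 / c⌉₊ + 3 ≤ L) {n : ℕ} (hn : n ≤ L ^ 2) {ψ : Fock (Orb (FermionTorus 2 L))}
    (hψ : IsGroundStateInSector (hubbardTorus 2 L 1 U) (2 * n) 0 ψ) (h1 : star ψ ⬝ᵥ ψ = 1)
    (hY : c * (L : ℝ) ^ 4 ≤
      (star ψ ⬝ᵥ (((pairField dWaveFormFactor L)ᴴ * pairField dWaveFormFactor L) *ᵥ ψ)).re) :
    c ≤ 1024 * U ^ ((2 : ℝ) / 3) := by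
  have h3 := pairDensity_cube_le_mul_coupling_sq hc hU hL hn hψ h1 hY
  have e1 : (c ^ 3) ^ ((3 : ℝ)⁻¹) = c := by
    have := Real.pow_rpow_inv_natCast hc.le (n := 3) (by norm_num)
    simpa using this
  have e2 : ((2 : ℝ) ^ 30 * U ^ 2) ^ ((3 : ℝ)⁻¹) = 1024 * U ^ ((2 : ℝ) / 3) := by
    rw [Real.mul_rpow (by positivity) (by positivity)]
    congr 1
    · rw [show (2 : ℝ) ^ 30 = 1024 ^ 3 by norm_num]
      have := Real.pow_rpow_inv_natCast (show (0 : ℝ) ≤ 1024 by norm_num) (n := 3) (by norm_num)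
      simpa using this
    · rw [← Real.rpow_natCast U 2, ← Real.rpow_mul hU]
      norm_num
  calc c = (c ^ 3) ^ ((3 : ℝ)⁻¹) := e1.symm
    _ ≤ ((2 : ℝ) ^ 30 * U ^ 2) ^ ((3 : ℝ)⁻¹) := Real.rpow_le_rpow (by positivity) h3 (by norm_num)
    _ = 1024 * U ^ ((2 : ℝ) / 3) := e2

/-- **Weak repulsion carries little `d`-wave pair order (rate `c^{3/2}`).** For `c > 0`,
`0 ≤ U < c√c/32768`, `L ≥ ⌈1536/c⌉ + 3` and `n ≤ L²`, EVERY normalised ground state `ψ` of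
`hubbardTorus 2 L 1 U` in the sector `(2n, S^z = 0)` has `Re ⟨ψ, Δ_d†Δ_d ψ⟩ < c·L⁴`.
Bardeen–Cooper–Schrieffer (1957) §II; Yang (1962) §3. [folklore] -/
theorem re_expect_pairField_dWave_lt_of_groundStateInSector_opt {c U : ℝ} (hc : 0 < c)
    (hU0 : 0 ≤ U) (hU : U < c * Real.sqrt c / 32768) (hL : ⌈1536 / c⌉₊ + 3 ≤ L) {n : ℕ}
    (hn : n ≤ L ^ 2) {ψ : Fock (Orb (FermionTorus 2 L))}
    (hψ : IsGroundStateInSector (hubbardTorus 2 L 1 U) (2 * n) 0 ψ) (h1 : star ψ ⬝ᵥ ψ = 1) :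
    (star ψ ⬝ᵥ (((pairField dWaveFormFactor L)ᴴ * pairField dWaveFormFactor L) *ᵥ ψ)).re <
      c * (L : ℝ) ^ 4 := by
  by_contra h
  push Not at h
  have := hubbardTorus_groundState_pairLRO_coupling_floor_opt hc hU0 hL hn hψ h1 h
  linarith

/-- **Ground-state `d`-wave pair density of the repulsive Hubbard torus is eventually below any `c`
with `c³ > 2³⁰ U²`** — uniformly in the filling and in the choice of ground state: for `U ≥ 0`,
`c > 0` with `2³⁰·U² < c³`, all sides `L ≥ ⌈1536/c⌉ + 3`, every `N` and every normalised ground state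
`ψ` of `hubbardTorus 2 L 1 U` in the sector `(N, S^z = 0)`: `Re ⟨ψ, Δ_d†Δ_d ψ⟩ < c·L⁴`. In particular
along any sequence of sector ground states `limsup_L L⁻⁴ Re⟨ψ_L, Δ_d†Δ_d ψ_L⟩ ≤ 1024·U^{2/3}`: an
explicit a-priori ceiling on the order parameter of the `HubbardSuperconductivity` summit at its own
witness coupling. Bardeen–Cooper–Schrieffer (1957) §II; Yang (1962) §3. [folklore] -/
theorem hubbardTorus_groundState_pairDensity_lt_of_coupling_sq_lt {c U : ℝ} (hc : 0 < c)
    (hU : 0 ≤ U) (hcU : 2 ^ 30 * U ^ 2 < c ^ 3) (hL : ⌈1536 / c⌉₊ + 3 ≤ L) {N : ℕ}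
    {ψ : Fock (Orb (FermionTorus 2 L))}
    (hψ : IsGroundStateInSector (hubbardTorus 2 L 1 U) N 0 ψ) (h1 : star ψ ⬝ᵥ ψ = 1) :
    (star ψ ⬝ᵥ (((pairField dWaveFormFactor L)ᴴ * pairField dWaveFormFactor L) *ᵥ ψ)).re <
      c * (L : ℝ) ^ 4 := by
  have h0 : ψ ≠ 0 := by rintro rfl; simp at h1
  obtain ⟨n, rfl⟩ := exists_eq_two_mul_of_mem_szSector_zero hψ.1 h0
  have hn := le_sq_of_mem_szSector_two_mul_zero hψ.1 h0
  by_contra h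
  push Not at h
  have := pairDensity_cube_le_mul_coupling_sq hc hU hL hn hψ h1 h
  linarith

end Literature.MathematicalPhysics.QuantumLattice
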